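import Summits.ResolutionOfSingularities.ResolutionOfSingularities.Theorems.PurelyInseparableDim4PhiLineFrameCoordinates
import Summits.ResolutionOfSingularities.ResolutionOfSingularities.Theorems.PurelyInseparableDim4PhiLineLinearLabel
import Summits.ResolutionOfSingularities.ResolutionOfSingularities.Theorems.PurelyInseparableDim4PhiLineFrameMoves
import Summits.ResolutionOfSingularities.ResolutionOfSingularities.Theorems.PurelyInseparableDim4PhiLineDeltaLabel
import HarnessLib

/-!
# (K-Φ2) chain dictionary IX: LABEL PROPAGATION — the arrival frame, re-adapted along `u₁` only, is a label with the same `(α, β)`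

Cell `res-dim4-pi` (D-0157 DOOR 2), Φ = β_h line of res-dim4-idea-1 (CARD I-1-8 (P2)/(C2) «the arrival frame is a label»). The one-step laws
((K-Φ2) IV `betaS_step_lt_of_keep` / `betaS_step_le_of_lose`) read the child residual `G′` in the CARRIED linear frame `c_A = ((Σ_t A i t·x_t)/1)_i`
(rows `y′₀, y′₁ ; u₁ = x_h, u₂ = x_m`) and need, for the NEXT step, that frame to be a LABEL again (`δ > 1`). This file proves (DEF-FREE) that when the
child is again an `e = 2` point whose restriction to `u = 0` is non-degenerate, and `0 < α < 1`, a re-adaptation of the `y`-rows ALONG `u₁` ONLY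
(`y″_k = y′_k + λ_k u₁`) produces a label frame with the SAME polygon vertex `(α, β)`:

* §1 `homogeneousComponent_linSubst`, `linSubst_mem_originIdeal_pow`, `natCast_le_ordZero_linSubst` — `σ_A` is graded and preserves `𝔪₀ⁿ`;
* §2 **`exists_readaptation_coordFrame`** (coordinate frame): `ord₀ P ≥ d`, `d < p`, `dim A(in P) ≥ 2`, the `u`-free part of `in P` non-degenerate,
  `αs(P/1) > 0` ⟹ `∃ λ, P ∈ (Y₀ + λ₀ U₁, Y₁ + λ₁ U₁)^d + 𝔪₀^{d+1}` — (K-Φ2) VI (`α > 0` ⇒ no `Y^{d−1}U₂` monomial ⇒ `h1` for `U₂`) fed into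
  (K-Φ3) VI `exists_linear_readaptation`, whose substitution then has NO `U₂`-component;
* §3 **`exists_label_readaptation`** (carried linear frame `A`, `A B = 1 = B A`): the same hypotheses transported by (K-Φ2) VIII give `λ` and the
  re-adapted frame `A″` (`A″_{y_k} = A_{y_k} + λ_k A_{u₁}`, `u`-rows unchanged, explicit inverse) with `pts ≠ ∅`, **`d! < δs`** ((K-Φ3) IV) and
  **`αs″ = αs`, `βs″ = βs`** ((K-Φ3) II: a `(1,0)`-dissolution below `α < 1` does not move the vertex).

[OURS · counted 0 · AI work weaker than expert review.] Nothing here proves K2(p), the β_h line, or resolution of singularities in dimension ≥ 4 /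
characteristic p.

Sources: V. Cossart, U. Jannsen, S. Saito (2020) Def. 8.2–8.4, Lemma 12.2, Thm. 8.16 [`CossartJannsenSaito2020`]; V. Cossart, O. Piltant,
J. Algebra 320 (2008) Prop. 4.2 [`CossartPiltant2008`].
-/

set_option linter.dupNamespace false

noncomputable section

namespace Summit.ResolutionOfSingularities.ResolutionOfSingularities.Theorems.PIDim4

namespace PhiLine

open MvPolynomial Finset IsLocalRing
open Literature.AlgebraicGeometry.Resolution
open Literature.AlgebraicGeometry.Resolution.Hauser2010
open Literature.AlgebraicGeometry.Resolution.WeightedOrder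
open Literature.AlgebraicGeometry.Resolution.PointBlowup (additiveSubspace killVars)

variable {K : Type} [Field K]

/-! ## §1 `σ_A` is graded and preserves the powers of `𝔪₀` -/

/-- `σ_A` commutes with taking the degree-`n` homogeneous component. [folklore] -/
theorem homogeneousComponent_linSubst (A : Matrix (Fin 4) (Fin 4) K) (F : MvPolynomial (Fin 4) K) (n : ℕ) :
    homogeneousComponent n (linSubst K A F) = linSubst K A (homogeneousComponent n F) := by
  classical
  conv_lhs => rw [← sum_homogeneousComponent F]
  rw [map_sum, map_sum, Finset.sum_eq_single n]
  · exact homogeneousComponent_eq_self (isHomogeneous_linSubst A (homogeneousComponent_isHomogeneous n F))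
  · intro i _ hi
    rw [homogeneousComponent_of_mem ((mem_homogeneousSubmodule i _).mpr (isHomogeneous_linSubst A (homogeneousComponent_isHomogeneous i F))),
      if_neg (Ne.symm hi)]
  · intro hn
    rw [Finset.mem_range, not_lt, Nat.succ_le_iff] at hn
    rw [homogeneousComponent_eq_zero _ _ hn, map_zero, map_zero]

/-- `σ_A (𝔪₀) ≤ 𝔪₀`. [folklore] -/
theorem map_linSubst_originIdeal_le (A : Matrix (Fin 4) (Fin 4) K) :
    (Literature.AlgebraicGeometry.Resolution.originIdeal K 4).map (linSubst K A) ≤ Literature.AlgebraicGeometry.Resolution.originIdeal K 4 := by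
  rw [Literature.AlgebraicGeometry.Resolution.originIdeal_eq_span, Ideal.map_span, Ideal.span_le]
  rintro _ ⟨_, ⟨i, rfl⟩, rfl⟩
  rw [SetLike.mem_coe, linSubst_X]
  exact Ideal.sum_mem _ fun j _ => Ideal.mul_mem_left _ _ (Ideal.subset_span ⟨j, rfl⟩)

/-- `σ_A (𝔪₀ⁿ) ⊆ 𝔪₀ⁿ`. [folklore] -/
theorem linSubst_mem_originIdeal_pow (A : Matrix (Fin 4) (Fin 4) K) {F : MvPolynomial (Fin 4) K} {n : ℕ}
    (hF : F ∈ Literature.AlgebraicGeometry.Resolution.originIdeal K 4 ^ n) :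
    linSubst K A F ∈ Literature.AlgebraicGeometry.Resolution.originIdeal K 4 ^ n :=
  Ideal.pow_right_mono (map_linSubst_originIdeal_le A) n (by rw [← Ideal.map_pow]; exact Ideal.mem_map_of_mem _ hF)

/-- `ord₀ (σ_A F) ≥ n` if `ord₀ F ≥ n`. [folklore] -/
theorem natCast_le_ordZero_linSubst (A : Matrix (Fin 4) (Fin 4) K) {F : MvPolynomial (Fin 4) K} {n : ℕ} (hF : (n : ℕ∞) ≤ ordZero F) :
    (n : ℕ∞) ≤ ordZero (linSubst K A F) := by
  rw [natCast_le_ordZero_iff_mem_idealOfVars_pow, ← originIdeal_eq_idealOfVars] at hF ⊢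
  exact linSubst_mem_originIdeal_pow A hF

/-- Row arithmetic: the linear form of the row `a + l • b` is `ℓ_a + l·ℓ_b`. [folklore] -/
theorem sum_C_add_smul_mul_X (a b : Fin 4 → K) (l : K) :
    (∑ t, C ((a + l • b) t) * X t : MvPolynomial (Fin 4) K) = ∑ t, C (a t) * X t + C l * ∑ t, C (b t) * X t := by
  rw [Finset.mul_sum, ← Finset.sum_add_distrib]
  refine Finset.sum_congr rfl fun t _ => ?_
  rw [Pi.add_apply, Pi.smul_apply, smul_eq_mul, C_add, C_mul, add_mul, mul_assoc]

/-! ## §2 The re-adaptation in the coordinate frame -/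

/-- **Re-adaptation along `u₁` only (coordinate frame).** Let `P ∈ K[x]` with `ord₀ P ≥ d`, `d < p = char K`, `Φ = in_d P`; assume
`dim_K A(Φ) ≥ 2`, that the `u`-free part `Φ(Y, 0, 0)` is non-degenerate (`A(Φ(Y,0,0)) ∩ {v_u = 0} = 0`), and `αs(P/1) > 0` in the coordinate
frame. Then for some `λ`, `P ∈ (Y₀ + λ₀U₁, Y₁ + λ₁U₁)^d + 𝔪₀^{d+1}`: by (K-Φ2) VI no monomial `Y^{d−1}U₂` occurs in `P` (`α > 0`), so
`∂_{U₂}Φ(Y,0,0) = 0` and the linear re-adaptation of (K-Φ3) VI has no `U₂`-component; it rewrites `Φ = Φ(Y − vU₁, 0, 0)`.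
[cite: CossartJannsenSaito2020, Lemma 12.2 (2)] [cite: CossartJannsenSaito2020, Def. 8.2 (3)] -/
theorem exists_readaptation_coordFrame (p : ℕ) [CharP K p] {d : ℕ} (hdp : d < p) {P : MvPolynomial (Fin 4) K}
    (hdP : (d : ℕ∞) ≤ ordZero P)
    (hT : 2 ≤ Module.finrank K (additiveSubspace (homogeneousComponent d P)))
    (hF' : ∀ v ∈ additiveSubspace (killVars ({u1 2, u2 2} : Finset (Fin (2 + 2))) (homogeneousComponent d P)),
      (∀ i ∈ ({u1 2, u2 2} : Finset (Fin (2 + 2))), v i = 0) → v = 0)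
    (hα : 0 < alphaS (fun i : Fin (2 + 2) => algebraMap (MvPolynomial (Fin 4) K) (OriginLocalization K 4) (X i))
      (Ideal.span {algebraMap (MvPolynomial (Fin 4) K) (OriginLocalization K 4) P}) d) :
    ∃ lam : Fin 2 → K, P ∈ Ideal.span (Set.range fun k : Fin 2 => (X (Fin.castAdd 2 k) + C (lam k) * X (u1 2) : MvPolynomial (Fin 4) K)) ^ d ⊔
      Literature.AlgebraicGeometry.Resolution.originIdeal K 4 ^ (d + 1) := by
  classical
  set U : Finset (Fin (2 + 2)) := {u1 2, u2 2} with hU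
  set Φ := homogeneousComponent d P with hΦ
  have hΦhom : Φ.IsHomogeneous d := homogeneousComponent_isHomogeneous d P
  have hdeg : Φ.totalDegree < p := lt_of_le_of_lt hΦhom.totalDegree_le hdp
  have hu1U : u1 2 ∈ U := by rw [hU]; exact Finset.mem_insert_self _ _
  have hu2U : u2 2 ∈ U := by rw [hU]; exact Finset.mem_insert_of_mem (Finset.mem_singleton_self _)
  have hT' : U.card ≤ Module.finrank K (additiveSubspace Φ) := by rw [hU, Finset.card_pair u1_ne_u2]; exact hT
  -- `α > 0` ⇒ no monomial `Y^{d-1} U₂` ⇒ `∂_{U₂} Φ (Y, 0, 0) = 0`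
  have h1 : killVars U (pderiv (u2 2) Φ) = 0 := by
    rw [killVars_eq_zero_iff_forall_coeff]
    intro β hβ
    rw [coeff_pderiv, hΦ, coeff_homogeneousComponent]
    split_ifs with hdeg'
    · have hβ1 : β (u1 2) = 0 := hβ _ hu1U
      have hβ2 : β (u2 2) = 0 := hβ _ hu2U
      have hdegβ : β.degree = ydeg β := by
        rw [Finsupp.degree_eq_sum, Fin.sum_univ_add, ydeg, add_eq_left, Fin.sum_univ_two]
        change β (u1 2) + β (u2 2) = 0
        rw [hβ1, hβ2]
      rw [map_add, Finsupp.degree_single, hdegβ] at hdeg'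
      have hy : ydeg β < d := by omega
      rw [coeff_add_single_u2_eq_zero_of_alphaS_pos hα hβ1 hy, zero_mul]
    · rw [zero_mul]
  -- (K-Φ3) VI: the linear re-adaptation, with no `U₂`-component
  obtain ⟨v, -, heq, hzero⟩ := exists_linear_readaptation U Φ p hdeg hT' hF'
  have hv2 : v (u2 2) = 0 := hzero _ hu2U h1
  refine ⟨fun k => -(v (u1 2) (Fin.castAdd 2 k)), ?_⟩
  set I : Ideal (MvPolynomial (Fin 4) K) :=
    Ideal.span (Set.range fun k : Fin 2 => (X (Fin.castAdd 2 k) + C (-(v (u1 2) (Fin.castAdd 2 k))) * X (u1 2) : MvPolynomial (Fin 4) K))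
    with hI
  set θ : Fin (2 + 2) → MvPolynomial (Fin 4) K := fun j => if j ∈ U then (0 : MvPolynomial (Fin 4) K) else X j - ∑ i ∈ U, C (v i j) * X i
    with hθ
  -- every `θ_j` lies in `I`
  have hθI : ∀ j, θ j ∈ I := by
    intro j
    by_cases hj : j ∈ U
    · rw [hθ]; dsimp only; rw [if_pos hj]; exact Ideal.zero_mem _
    · rw [hθ]; dsimp only; rw [if_neg hj, hU, Finset.sum_pair u1_ne_u2, hv2, Pi.zero_apply, C_0, zero_mul, add_zero]
      obtain ⟨k, rfl⟩ : ∃ k : Fin 2, j = Fin.castAdd 2 k := by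
        induction j using Fin.addCases with
        | left k => exact ⟨k, rfl⟩
        | right k =>
          exfalso; apply hj; rw [hU]
          fin_cases k
          · exact Finset.mem_insert_self _ _
          · exact Finset.mem_insert_of_mem (Finset.mem_singleton_self _)
      refine hI ▸ Ideal.subset_span ⟨k, ?_⟩
      show X (Fin.castAdd 2 k) + C (-(v (u1 2) (Fin.castAdd 2 k))) * X (u1 2) = _
      rw [map_neg, neg_mul, sub_eq_add_neg]
  have hmapI : (Literature.AlgebraicGeometry.Resolution.originIdeal K 4).map (aeval θ) ≤ I := by
    rw [Literature.AlgebraicGeometry.Resolution.originIdeal_eq_span, Ideal.map_span, Ideal.span_le]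
    rintro _ ⟨_, ⟨i, rfl⟩, rfl⟩
    rw [SetLike.mem_coe, aeval_X]
    exact hθI i
  -- `Φ ∈ 𝔪₀^d`, hence `Φ = θ(Φ) ∈ I^d`
  have hΦmem : Φ ∈ Literature.AlgebraicGeometry.Resolution.originIdeal K 4 ^ d := by
    rw [originIdeal_eq_idealOfVars, mem_pow_idealOfVars_iff]
    intro x hx
    have h : x.degree = d := by rw [Finsupp.degree_eq_weight_one]; exact hΦhom (mem_support_iff.mp hx)
    exact h.ge
  have hΦI : Φ ∈ I ^ d := by
    rw [← heq]
    exact Ideal.pow_right_mono hmapI d (by rw [← Ideal.map_pow]; exact Ideal.mem_map_of_mem _ hΦmem)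
  -- `P − Φ ∈ 𝔪₀^{d+1}`
  have hrest : P - Φ ∈ Literature.AlgebraicGeometry.Resolution.originIdeal K 4 ^ (d + 1) := by
    rw [originIdeal_eq_idealOfVars, mem_pow_idealOfVars_iff']
    intro x hx
    rw [coeff_sub, hΦ, coeff_homogeneousComponent]
    split_ifs with hxd
    · exact sub_self _
    · have hlt : x.degree < d := by omega
      have hP : P ∈ MvPolynomial.idealOfVars (Fin 4) K ^ d := (natCast_le_ordZero_iff_mem_idealOfVars_pow P d).mp hdP
      rw [mem_pow_idealOfVars_iff'] at hP
      rw [hP x hlt, sub_zero]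
  rw [show P = Φ + (P - Φ) by ring]
  exact Submodule.add_mem_sup hΦI hrest

/-! ## §3 The re-adaptation in a carried linear frame -/

/-- The unipotent re-adaptation matrix and its inverse. [folklore] -/
theorem readaptMatrix_mul_eq_one (lam : Fin 2 → K) :
    (!![1, 0, lam 0, 0; 0, 1, lam 1, 0; 0, 0, 1, 0; 0, 0, 0, 1] : Matrix (Fin 4) (Fin 4) K) *
        !![1, 0, -lam 0, 0; 0, 1, -lam 1, 0; 0, 0, 1, 0; 0, 0, 0, 1] = 1 ∧
      (!![1, 0, -lam 0, 0; 0, 1, -lam 1, 0; 0, 0, 1, 0; 0, 0, 0, 1] : Matrix (Fin 4) (Fin 4) K) *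
        !![1, 0, lam 0, 0; 0, 1, lam 1, 0; 0, 0, 1, 0; 0, 0, 0, 1] = 1 := by
  constructor <;> (ext i j; fin_cases i <;> fin_cases j <;> simp [Matrix.mul_apply, Fin.sum_univ_four])

/-- Rows of the re-adapted frame `E·A`: `y`-rows `A_{y_k} + λ_k A_{u₁}`, `u`-rows unchanged. [folklore] -/
theorem readaptMatrix_mul_rows (lam : Fin 2 → K) (A : Matrix (Fin 4) (Fin 4) K) :
    (∀ k : Fin 2, ((!![1, 0, lam 0, 0; 0, 1, lam 1, 0; 0, 0, 1, 0; 0, 0, 0, 1] : Matrix (Fin 4) (Fin 4) K) * A) (Fin.castAdd 2 k) =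
        A (Fin.castAdd 2 k) + lam k • A (u1 2)) ∧
      ((!![1, 0, lam 0, 0; 0, 1, lam 1, 0; 0, 0, 1, 0; 0, 0, 0, 1] : Matrix (Fin 4) (Fin 4) K) * A) (u1 2) = A (u1 2) ∧
      ((!![1, 0, lam 0, 0; 0, 1, lam 1, 0; 0, 0, 1, 0; 0, 0, 0, 1] : Matrix (Fin 4) (Fin 4) K) * A) (u2 2) = A (u2 2) := by
  have hu1 : (u1 2 : Fin 4) = 2 := rfl
  have hu2 : (u2 2 : Fin 4) = 3 := rfl
  refine ⟨fun k => ?_, ?_, ?_⟩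
  · funext t
    fin_cases k
    · show _ = (A 0 + lam 0 • A 2) t
      simp [Matrix.mul_apply, Fin.sum_univ_four]
    · show _ = (A 1 + lam 1 • A 2) t
      simp [Matrix.mul_apply, Fin.sum_univ_four]
  · funext t; rw [hu1]; simp [Matrix.mul_apply, Fin.sum_univ_four]
  · funext t; rw [hu2]; simp [Matrix.mul_apply, Fin.sum_univ_four]

/-- `B A = 1` as the left-inverse condition `Σ_i B t i · A i s = δ_{ts}` of (K-Φ2) III. [folklore] -/
theorem sum_mul_eq_ite_of_mul_eq_one {A B : Matrix (Fin 4) (Fin 4) K} (hBA : B * A = 1) (t s : Fin 4) :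
    ∑ i : Fin (2 + 2), B t i * A i s = if t = s then 1 else 0 := by
  have h := congrFun (congrFun hBA t) s
  rw [Matrix.mul_apply, Matrix.one_apply] at h
  exact h

/-- **LABEL PROPAGATION (carried linear frame).** Let `G′` be the child residual read in the carried frame `A` (`A B = 1 = B A`; rows
`y′₀, y′₁ ; u₁, u₂`), `ord₀ G′ ≥ d`, `d < p`. Assume the child is an `e ≥ 2` point (`dim A(in_d G′) ≥ 2`), that the `u`-free part of `in_d G′`
in frame coordinates is non-degenerate, and `0 < αs < d!` with `pts ≠ ∅` in the frame `A`. Then there are `λ` and an invertible re-adapted frame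
`A″` — `A″_{y_k} = A_{y_k} + λ_k A_{u₁}`, `A″_{u} = A_{u}` — in which `(G′/1)` has non-empty polygon, **`d! < δs` (label)** and the SAME `αs`, `βs`.
[cite: CossartJannsenSaito2020, Def. 8.2 (3), Def. 8.4, Lemma 12.2 (2), Thm. 8.16] [cite: CossartPiltant2008, Prop. 4.2] -/
theorem exists_label_readaptation (p : ℕ) [CharP K p] {d : ℕ} (hdp : d < p) {A B : Matrix (Fin 4) (Fin 4) K} (hAB : A * B = 1)
    (hBA : B * A = 1) {G : MvPolynomial (Fin 4) K} (hdG : (d : ℕ∞) ≤ ordZero G)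
    (hT : 2 ≤ Module.finrank K (additiveSubspace (homogeneousComponent d G)))
    (hF' : ∀ v ∈ additiveSubspace (killVars ({u1 2, u2 2} : Finset (Fin (2 + 2))) (homogeneousComponent d (linSubst K B G))),
      (∀ i ∈ ({u1 2, u2 2} : Finset (Fin (2 + 2))), v i = 0) → v = 0)
    (hne : (pts (fun i : Fin (2 + 2) => algebraMap (MvPolynomial (Fin 4) K) (OriginLocalization K 4) (∑ t, C (A i t) * X t))
      (Ideal.span {algebraMap (MvPolynomial (Fin 4) K) (OriginLocalization K 4) G}) d).Nonempty)
    (hα0 : 0 < alphaS (fun i : Fin (2 + 2) => algebraMap (MvPolynomial (Fin 4) K) (OriginLocalization K 4) (∑ t, C (A i t) * X t))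
      (Ideal.span {algebraMap (MvPolynomial (Fin 4) K) (OriginLocalization K 4) G}) d)
    (hα1 : alphaS (fun i : Fin (2 + 2) => algebraMap (MvPolynomial (Fin 4) K) (OriginLocalization K 4) (∑ t, C (A i t) * X t))
      (Ideal.span {algebraMap (MvPolynomial (Fin 4) K) (OriginLocalization K 4) G}) d < d.factorial) :
    ∃ lam : Fin 2 → K, ∃ A' B' : Matrix (Fin 4) (Fin 4) K, A' * B' = 1 ∧ B' * A' = 1 ∧
      (∀ k : Fin 2, A' (Fin.castAdd 2 k) = A (Fin.castAdd 2 k) + lam k • A (u1 2)) ∧ A' (u1 2) = A (u1 2) ∧ A' (u2 2) = A (u2 2) ∧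
      (pts (fun i : Fin (2 + 2) => algebraMap (MvPolynomial (Fin 4) K) (OriginLocalization K 4) (∑ t, C (A' i t) * X t))
        (Ideal.span {algebraMap (MvPolynomial (Fin 4) K) (OriginLocalization K 4) G}) d).Nonempty ∧
      d.factorial < deltaS (fun i : Fin (2 + 2) => algebraMap (MvPolynomial (Fin 4) K) (OriginLocalization K 4) (∑ t, C (A' i t) * X t))
        (Ideal.span {algebraMap (MvPolynomial (Fin 4) K) (OriginLocalization K 4) G}) d ∧
      alphaS (fun i : Fin (2 + 2) => algebraMap (MvPolynomial (Fin 4) K) (OriginLocalization K 4) (∑ t, C (A' i t) * X t))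
          (Ideal.span {algebraMap (MvPolynomial (Fin 4) K) (OriginLocalization K 4) G}) d =
        alphaS (fun i : Fin (2 + 2) => algebraMap (MvPolynomial (Fin 4) K) (OriginLocalization K 4) (∑ t, C (A i t) * X t))
          (Ideal.span {algebraMap (MvPolynomial (Fin 4) K) (OriginLocalization K 4) G}) d ∧
      betaS (fun i : Fin (2 + 2) => algebraMap (MvPolynomial (Fin 4) K) (OriginLocalization K 4) (∑ t, C (A' i t) * X t))
          (Ideal.span {algebraMap (MvPolynomial (Fin 4) K) (OriginLocalization K 4) G}) d =
        betaS (fun i : Fin (2 + 2) => algebraMap (MvPolynomial (Fin 4) K) (OriginLocalization K 4) (∑ t, C (A i t) * X t))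
          (Ideal.span {algebraMap (MvPolynomial (Fin 4) K) (OriginLocalization K 4) G}) d := by
  classical
  set alg := algebraMap (MvPolynomial (Fin 4) K) (OriginLocalization K 4) with halg
  set c : Fin (2 + 2) → OriginLocalization K 4 := fun i => alg (∑ t, C (A i t) * X t) with hc
  -- §2 in frame coordinates `P = σ_B G`
  have hdP : (d : ℕ∞) ≤ ordZero (linSubst K B G) := natCast_le_ordZero_linSubst B hdG
  have hT' : 2 ≤ Module.finrank K (additiveSubspace (homogeneousComponent d (linSubst K B G))) := by
    rw [homogeneousComponent_linSubst, finrank_additiveSubspace_linSubst p hBA hAB (homogeneousComponent_isHomogeneous d G) hdp]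
    exact hT
  have hα' : 0 < alphaS (fun i : Fin (2 + 2) => alg (X i)) (Ideal.span {alg (linSubst K B G)}) d := by
    rw [halg, ← alphaS_linearFrame_eq_alphaS_coordFrame hAB hBA]; exact hα0
  obtain ⟨lam, hmem⟩ := exists_readaptation_coordFrame p hdp hdP hT' hF' hα'
  -- the re-adapted frame
  set E : Matrix (Fin 4) (Fin 4) K := !![1, 0, lam 0, 0; 0, 1, lam 1, 0; 0, 0, 1, 0; 0, 0, 0, 1] with hE
  set E' : Matrix (Fin 4) (Fin 4) K := !![1, 0, -lam 0, 0; 0, 1, -lam 1, 0; 0, 0, 1, 0; 0, 0, 0, 1] with hE'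
  obtain ⟨hEE', hE'E⟩ := readaptMatrix_mul_eq_one lam
  obtain ⟨hrow, hrow1, hrow2⟩ := readaptMatrix_mul_rows lam A
  rw [← hE, ← hE'] at hEE' hE'E
  rw [← hE] at hrow hrow1 hrow2
  have hA'B' : E * A * (B * E') = 1 := by rw [Matrix.mul_assoc, ← Matrix.mul_assoc A, hAB, Matrix.one_mul, hEE']
  have hB'A' : B * E' * (E * A) = 1 := by rw [Matrix.mul_assoc, ← Matrix.mul_assoc E', hE'E, Matrix.one_mul, hBA]
  set c' : Fin (2 + 2) → OriginLocalization K 4 := fun i => alg (∑ t, C ((E * A) i t) * X t) with hc'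
  -- `c'` IS the `(1, 0)`-dissolution of `c` with coefficients `λ_k`
  have hdis : c' = yShift c fun k => uMonom c (alg (C (lam k))) 1 0 := by
    funext i
    induction i using Fin.addCases with
    | left k =>
      rw [yShift_y, uMonom, hc', hc]
      dsimp only
      rw [hrow k, sum_C_add_smul_mul_X, map_add, map_mul, pow_one, pow_zero, mul_one]
    | right j =>
      fin_cases j
      · change c' (u1 2) = yShift c _ (u1 2)
        rw [yShift_u1, hc', hc]; dsimp only; rw [hrow1]
      · change c' (u2 2) = yShift c _ (u2 2)
        rw [yShift_u2, hc', hc]; dsimp only; rw [hrow2]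
  -- the standing binders of the frame `c`
  have hgen : Ideal.span (Set.range c) = maximalIdeal (OriginLocalization K 4) :=
    span_range_linearFrame_eq_maximalIdeal (fun i => A i) (fun t i => B t i) (sum_mul_eq_ite_of_mul_eq_one hBA)
  have hgen' : Ideal.span (Set.range c') = maximalIdeal (OriginLocalization K 4) :=
    span_range_linearFrame_eq_maximalIdeal (fun i => (E * A) i) (fun t i => (B * E') t i) (sum_mul_eq_ite_of_mul_eq_one hB'A')
  have hdim := ringKrullDim_originLocalization_two_add_two (K := K)
  have hJμ : Ideal.span {alg G} ≤ maximalIdeal (OriginLocalization K 4) ^ d := span_singleton_algebraMap_le_maximalIdeal_pow hdG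
  -- (K-Φ3) II: the dissolution does not move the vertex
  obtain ⟨hne', hαeq, hβeq⟩ := pts_yShift_uMonom_nonempty_and_alphaS_betaS_eq c (fun k => alg (C (lam k))) 1 0 hgen hdim hJμ hne
    Nat.one_pos (by rw [one_mul]; exact hα1)
  rw [← hdis] at hne' hαeq hβeq
  -- the label condition in the re-adapted frame, pulled back from frame coordinates by `σ_A`
  have hGmem : G ∈ Ideal.span (Set.range fun k : Fin 2 => (∑ s, C ((E * A) (Fin.castAdd 2 k) s) * X s : MvPolynomial (Fin 4) K)) ^ d ⊔
      Literature.AlgebraicGeometry.Resolution.originIdeal K 4 ^ (d + 1) := by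
    have h := Ideal.mem_map_of_mem (linSubst K A) hmem
    rw [linSubst_linSubst_of_mul_eq_one hBA, Ideal.map_sup, Ideal.map_pow, Ideal.map_pow, Ideal.map_span, ← Set.range_comp] at h
    have hfun : (⇑(linSubst K A) ∘ fun k : Fin 2 => (X (Fin.castAdd 2 k) + C (lam k) * X (u1 2) : MvPolynomial (Fin 4) K)) =
        fun k : Fin 2 => (∑ s, C ((E * A) (Fin.castAdd 2 k) s) * X s : MvPolynomial (Fin 4) K) := by
      funext k
      rw [Function.comp_apply, map_add, map_mul, linSubst_X, linSubst_X, hrow k, sum_C_add_smul_mul_X, linSubst, aeval_C, algebraMap_eq]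
    rw [hfun] at h
    exact (sup_le_sup le_rfl (Ideal.pow_right_mono (map_linSubst_originIdeal_le A) (d + 1))) h
  have hδ : d.factorial < deltaS c' (Ideal.span {alg G}) d :=
    factorial_lt_deltaS_of_le_yIdeal_pow_sup c' d hgen' hdim (span_singleton_algebraMap_le_yIdeal_pow_sup (fun i => (E * A) i) hGmem) hne'
  exact ⟨lam, E * A, B * E', hA'B', hB'A', hrow, hrow1, hrow2, hne', hδ, hαeq, hβeq⟩

end PhiLine

end Summit.ResolutionOfSingularities.ResolutionOfSingularities.Theorems.PIDim4

end
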